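import Literature.NumberTheory.EllipticCurves.ComplexMultiplicationShaRubinScalarsProofs
import Literature.NumberTheory.EllipticCurves.IsogenyGeomEndRingQuadraticProofs
import Literature.NumberTheory.EllipticCurves.IsogenyGeomEndRingProofs
import Literature.NumberTheory.EllipticCurves.IsogenyFactorProofs
import Literature.NumberTheory.EllipticCurves.MordellWeilProofs
import Mathlib.Tactic.LinearCombination
import Mathlib.Tactic.Module
import HarnessLib

/-!
# bsd.S28 (Rubin): `Ш_𝔭 = 0` for `𝔭 ∤ 𝒴` — `deg α = N(α)` on `ℤ[φ] ⊆ End_K(E)` and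
`E[p] ⊄ E[φ - a]` (towards Rubin 1999, Prop. 5.4 at a split prime)

Sibling *proofs* file (theorems only: no definition, no named fact, no instance) for the named
fact `Literature.NumberTheory.EllipticCurves.Rubin1987_sha_torsionBy_eq_bot_cofinite`
(`ComplexMultiplicationShaRubinProofs.lean`; K. Rubin, Invent. Math. 89 (1987), **Thm. 6.6**).
The companion `…RubinScalarsProofs.lean` proved the two CM inputs of the descent (Rubin 1999,
Cor. 5.5 / Lemma 6.1) at a prime `p` **inert** in `𝒪 = ℤ[φ]`, where `E[p]` is a line over the
field `𝒪/p`; at a **split** prime `p = 𝔭𝔭̄` the same needs **Prop. 5.4**: *"If `𝔞` is a nonzero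
ideal of `𝒪` then `E[𝔞] ≅ 𝒪/𝔞` as `𝒪`-modules"* (LNM 1716, §5.1, p. 182; printed proof: the
analytic parametrisation `E(ℂ) ≅ ℂ/L`, `E[𝔞] ≅ 𝔞⁻¹L/L`), i.e. that `E[𝔭] = E[p] ∩ ker(φ - a)`
(`a` a root of the minimal polynomial of `φ` mod `p`) is a *line* and not all of `E[p]`.

This file proves the algebraic heart of that statement from the tree's theory of isogenies and
degrees (Silverman, *AEC*, III.§4, III.§6), with no analysis:

* `Rubin1987.degHom_eq_norm` — **`deg = N` and `tr = Tr` on `ℤ[φ]`**: if `φ ∈ Hom_K(E, E)`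
  satisfies `φ² - tφ + m = 0` with `t² < 4m` (an imaginary quadratic integer), then `deg φ = m`
  and `deg(φ + 1) - deg φ - 1 = t`; hence (`Rubin1987.degHom_sub_intCast_eq`)
  `deg(φ - a) = a² - ta + m = N(φ - a)` for every `a ∈ ℤ`. Proof: the tree's
  `φ² - (deg(φ+1) - deg φ - 1)φ + deg φ = 0` (`comp_self_sub_smul_add_smul_id_eq_zero`, Cor. III.6.3
  with the multiplicativity of `deg`) against the given relation leaves `(t - t')φ = (m - d')`,
  and `t ≠ t'` would make `x² - tx + m` have the rational root `(m - d')/(t - t')`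
  (`(2c - tk)² + (4m - t²)k² = 0`), so `t' = t`, `d' = m`; then Cor. III.6.3 (the quadratic form,
  `degHom_add_zsmul`) gives `deg(φ - a)`. (Silverman, *AEC*, III.§9, Cor. III.9.4 / Rubin's use of
  `deg [α] = N(α)`; Lang, *Elliptic Functions*, 13 §1.)
* `Rubin1987.exists_mem_geomTorsion_sub_smul_ne_zero` — **`E[p] ⊄ ker(φ - a)` when
  `p² ∤ N(φ - a)`**: for a `K`-rational endomorphism `φ ∈ End_K(E)` as above, `p ≠ 0` in `K`
  (any natural number; a prime in the application) and `a ∈ ℤ` with `p² ∤ a² - ta + m`, some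
  `P ∈ E[p]` has `φP ≠ aP`. Otherwise the isogeny
  `φ - a` kills `E[p]` and factors as `λ ∘ [p]` (Silverman Cor. III.4.11, tree
  `Isogeny.exists_eq_comp_zsmul_of_geomTorsion_le_ker`), so `N(φ - a) = deg(φ - a) = p² deg λ`.
  For `p` split and unramified in `ℤ[φ]` a root `a` of `x² - tx + m` mod `p` can always be lifted
  with `p² ∤ f(a)` (`f(a + p) ≡ f(a) + p f'(a) (mod p²)`, `f'(a) ≢ 0`), which is how this feeds
  the eigenline decomposition `E[p] = E[𝔭] ⊕ E[𝔭̄]` of the split case below.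

* `Rubin1987.eq_zero_of_smul_eigen_add_smul_eigen_eq_zero`,
  `Rubin1987.eq_zero_of_smul_add_smul_φ_eq_zero_split`,
  `Rubin1987.exists_eq_smul_add_smul_of_comm_of_cyclic`, `Rubin1987.comm_of_comm_of_cyclic`,
  `Rubin1987.bijective_sub_id_of_comm_split` — the `𝔽_p`-linear algebra of the split case:
  eigenvectors `va, vb` for `a ≠ b` are independent, `va + vb` is a cyclic vector, so (by the
  counting of the inert case) every map commuting with `φ` is `α + βφ`, any two commute, and such a
  map moving both eigenvectors has `g - 1` bijective;
* `Rubin1987.smul_comm_and_exists_bijective_of_split` — **the two CM inputs at a split prime**: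
  with `a + b ≡ t`, `ab ≡ m`, `a ≢ b (mod p)` and `p² ∤ f(a), f(b)`, the eigenvectors
  `va = (φ - b)P ∈ E[𝔭]`, `vb = (φ - a)Q ∈ E[𝔭̄]` exist by the previous theorem, so `Γ_K` is
  commutative on `E[p]`, and if `E[p]` has no non-zero `Γ_K`-fixed point, some
  `g₀ ∈ {σ_a, σ_b, σ_aσ_b}` moves both eigenlines and `g₀ - 1` is bijective;
* `Rubin1987.geomTorsion_eq_zero_of_forall_smul_eq`,
  `Rubin1987.subgroupResKer_torsionFixing_eq_bot_of_split`,
  `Rubin1987.sha_torsionBy_eq_zero_of_forall_unramifiedHoms_eq_zero_of_split` — over a number field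
  and for `p ∤ #E(K)_tors`: no fixed points, hence `ker (H¹(K, E[p]) → H¹(K(E[p]), E[p])) = 0`
  (`…RubinHomDescentProofs`) and the `Ш(E/K)[p] = 0` criterion, unconditionally at such split `p`.

* `Rubin1987.exists_split_data`, `Rubin1987.exists_forall_prime_sha_torsionBy_eq_zero` — **all but
  finitely many primes**: for `p ∤ #E(K)_tors · (4m - t²)` either `x² - tx + m` is irreducible mod
  `p` (inert: `…RubinScalarsProofs`) or it has a simple root, whose good lift mod `p²` gives the
  split data above; hence there is `N > 0` such that for every prime `p ∤ N` the vanishing of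
  `Hom_{Γ_K}(Γ_{K(E[p])}, E[p]; S)` implies `Ш(E/K)[p] = 0` — the descent side of Thm. 6.6 /
  Thm. A (b) with every CM input discharged.

## Faithfulness notes

* Rubin proves Prop. 5.4 analytically; the statement extracted here (`E[𝔭] ≠ E[p]`, with
  `deg = N`) is what Cor. 5.5 / Lemma 6.1 consume at a split prime, obtained algebraically from
  Silverman III.4.11 and III.6.3 as available in the tree. The hypothesis `φ ∈ End_K(E)`
  (`W.endRing`), `φ² = tφ - m`, `t² < 4m` is Rubin's standing assumption "`E` has complex
  multiplication by `𝒪 ∋ φ` over `K ⊇ K_φ`"; it is displayed, not assumed as a fact (D-0026).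
* No statement of the fact is changed; no definition, named fact or instance is introduced.

## References

* K. Rubin, *Elliptic curves with complex multiplication and the conjecture of Birch and
  Swinnerton-Dyer*, LNM 1716 (1999): §5.1, Prop. 5.4, Cor. 5.5; §6.1, Lemma 6.1. [Rubin1999]
* K. Rubin, *Tate–Shafarevich groups and L-functions of elliptic curves with complex
  multiplication*, Invent. Math. 89 (1987): §1, Thm. 6.6. [Rubin1987Sha]
* J. H. Silverman, *The Arithmetic of Elliptic Curves*, 2nd ed. (2009): Cor. III.4.11,
  Cor. III.6.3, Cor. III.9.4 (through `IsogenyFactorProofs`, `IsogenyDeterminantProofs`,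
  `IsogenyDegreeQuadraticFormProofs`, `IsogenyGeomEndRingQuadraticProofs`). [SilvermanAEC2009]
-/

noncomputable section

open scoped Classical
open WeierstrassCurve Field

universe u

namespace Literature.NumberTheory.EllipticCurves

namespace Rubin1987

variable {K : Type u} [Field K] (W : WeierstrassCurve K) [W.IsElliptic]

/-! ### `deg = N` on `ℤ[φ]` -/

/-- **A non-zero integer does not kill `E(K̄)`**: if `n • P = 0` for every geometric point then
`n = 0` (`End_{K̄}(E)` has characteristic `0`, tree `charZero_geomEndRing`: `E[n]` is finite and
`E(K̄)` infinite). [cite: SilvermanAEC2009, Prop. III.4.2(b)] -/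
theorem int_eq_zero_of_forall_zsmul_eq_zero {n : ℤ} (hn : ∀ P : W.geomPoints, n • P = 0) :
    n = 0 := by
  haveI := W.charZero_geomEndRing
  have h1 : (n : AddMonoid.End W.geomPoints) = 0 :=
    DFunLike.ext _ _ fun P ↦ by
      rw [AddMonoid.End.intCast_apply, AddMonoid.End.zero_apply]
      exact hn P
  have h2 : (n : W.geomEndRing) = 0 :=
    Subtype.ext (by rw [SubringClass.coe_intCast, ZeroMemClass.coe_zero]; exact h1)
  exact Int.cast_eq_zero.1 h2

/-- **`deg φ = N(φ)` and `deg(φ + 1) - deg φ - 1 = Tr(φ)` for an imaginary quadratic integer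
`φ ∈ Hom_K(E, E)`**: if `φ (φ P) = t φP - m P` for all `P` with `t² < 4m`, then the degree of `φ`
(`degHom`, Silverman's `deg` extended by `deg 0 = 0`) is `m` and the polar pairing of `φ` with `1`
is `t`. From the tree's `φ² - (deg(φ+1) - deg φ - 1)φ + deg φ = 0` (Cor. III.6.3 +
multiplicativity): the difference of the two relations is `(t - t')φ = (m - d')`, and `t ≠ t'`
would give `(2(m - d') - t(t - t'))² + (4m - t²)(t - t')² = 0`.
[cite: SilvermanAEC2009, Cor. III.6.3, Cor. III.9.4] [cite: Rubin1999, Prop. 5.4] -/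
theorem degHom_eq_norm {φ : W.geomPoints →+ W.geomPoints} (hφm : φ ∈ homModule W W) {t m : ℤ}
    (hrel : ∀ P, φ (φ P) = t • φ P - m • P) (hdisc : t ^ 2 < 4 * m) :
    degHom W W φ = m ∧ degHom W W (φ + AddMonoidHom.id _) - degHom W W φ - 1 = t := by
  have h63 := degHom_isQuadraticForm_holds W W
  set t' : ℤ := degHom W W (φ + AddMonoidHom.id _) - degHom W W φ - 1 with ht'
  set d' : ℤ := degHom W W φ with hd'
  have hq := comp_self_sub_smul_add_smul_id_eq_zero h63 hφm
  -- `(t - t') φP = (m - d') P` for all `P`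
  have hlin : ∀ P, (t - t') • φ P = (m - d') • P := by
    intro P
    have h2 : φ (φ P) - t' • φ P + d' • P = 0 :=
      congrArg (fun g : W.geomPoints →+ W.geomPoints ↦ g P) hq
    rw [hrel P] at h2
    linear_combination (norm := module) h2
  by_cases hk : t - t' = 0
  · -- `t' = t`, then `(m - d') P = 0` for all `P`, so `d' = m`
    have hmd : m - d' = 0 :=
      int_eq_zero_of_forall_zsmul_eq_zero W fun P ↦ by rw [← hlin P, hk, zero_smul]
    constructor <;> omega
  · exfalso
    -- `φ` would be the rational number `(m - d')/(t - t')`, a root of `x² - tx + m`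
    have hkey : ∀ P : W.geomPoints,
        ((t - t') * t * (m - d') - (m - d') ^ 2 - (t - t') ^ 2 * m) • P = 0 := by
      intro P
      have h1 := hlin P
      have h2 := hlin (φ P)
      rw [hrel P] at h2
      linear_combination (norm := module) ((m - d') - (t - t') * t) • h1 + (t - t') • h2
    have h0 := int_eq_zero_of_forall_zsmul_eq_zero W hkey
    have hsq : (2 * (m - d') - t * (t - t')) ^ 2 + (4 * m - t ^ 2) * (t - t') ^ 2 = 0 := by
      linear_combination (-4 : ℤ) * h0
    have h1 : 0 ≤ (2 * (m - d') - t * (t - t')) ^ 2 := sq_nonneg _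
    have h2 : 0 < (4 * m - t ^ 2) * (t - t') ^ 2 :=
      mul_pos (by omega) (by positivity)
    omega

/-- **`deg(φ - a) = a² - ta + m = N(φ - a)`** for every integer `a` (hypotheses of
`degHom_eq_norm`): Cor. III.6.3 (`deg` is a quadratic form with polar pairing `B`,
`deg(φ + n) = deg φ + n B(φ, 1) + n²`, tree `degHom_add_zsmul`) with `deg φ = m`, `B(φ, 1) = t`.
[cite: SilvermanAEC2009, Cor. III.6.3] [cite: Rubin1999, Prop. 5.4] -/
theorem degHom_sub_intCast_eq {φ : W.geomPoints →+ W.geomPoints} (hφm : φ ∈ homModule W W)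
    {t m : ℤ} (hrel : ∀ P, φ (φ P) = t • φ P - m • P) (hdisc : t ^ 2 < 4 * m) (a : ℤ) :
    degHom W W (φ + (-a) • AddMonoidHom.id _) = a ^ 2 - t * a + m := by
  have h63 := degHom_isQuadraticForm_holds W W
  obtain ⟨hd, ht⟩ := degHom_eq_norm W hφm hrel hdisc
  rw [hd] at ht
  rw [degHom_add_zsmul h63 hφm (id_mem_homModule W) (-a), degHom_id, hd]
  linear_combination (-a) * ht

/-! ### `E[p] ⊄ ker(φ - a)` when `p² ∤ N(φ - a)` -/

/-- **Some `P ∈ E[p]` has `φP ≠ aP` when `p² ∤ a² - ta + m`.** Let `φ ∈ End_K(E)` be a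
`K`-rational endomorphism with `φ² = tφ - m`, `t² < 4m`, let `p` be a natural number with
`p ≠ 0` in `K` (a prime, in the application), and `a ∈ ℤ` with `p² ∤ a² - ta + m`. If `φ - a` killed `E[p]`, then — being a non-zero element of
`End_K(E)`, hence an isogeny over `K` (`mem_geomEndRing_iff_holds`) — it would factor as
`λ ∘ [p]` (Silverman Cor. III.4.11, tree `Isogeny.exists_eq_comp_zsmul_of_geomTorsion_le_ker`) and
`a² - ta + m = deg(φ - a) = deg λ · p²` (`degHom_comp`, `degHom_zsmul`). This is the content of
Rubin's Prop. 5.4 used at a split prime: `E[𝔭] = E[p] ∩ ker(φ - a) ≠ E[p]`.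
[cite: Rubin1999, Prop. 5.4, Cor. 5.5] [cite: SilvermanAEC2009, Cor. III.4.11, Cor. III.6.3] -/
theorem exists_mem_geomTorsion_sub_smul_ne_zero {φ : AddMonoid.End W.geomPoints}
    (hφ : φ ∈ W.endRing) {t m : ℤ} (hrel : ∀ P : W.geomPoints, φ (φ P) = t • φ P - m • P)
    (hdisc : t ^ 2 < 4 * m) {p : ℕ} (hpK : (p : K) ≠ 0) {a : ℤ}
    (ha : ¬ (p : ℤ) ^ 2 ∣ a ^ 2 - t * a + m) :
    ∃ P ∈ geomTorsion W p, φ P - a • P ≠ 0 := by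
  by_contra hall
  push Not at hall
  -- view `φ` as an additive map
  set φ' : W.geomPoints →+ W.geomPoints := φ with hφ'def
  have hrel' : ∀ P, φ' (φ' P) = t • φ' P - m • P := fun P ↦ hrel P
  have hall' : ∀ P ∈ geomTorsion W p, φ' P - a • P = 0 := fun P hP ↦ hall P hP
  -- `ψ = φ - a`, as an additive map and as an element of `End_K(E)`
  set ψ : W.geomPoints →+ W.geomPoints := φ' + (-a) • AddMonoidHom.id _ with hψ
  have hψapply : ∀ P, ψ P = φ' P - a • P := fun P ↦ by
    rw [hψ]
    change φ' P + (-a) • P = φ' P - a • P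
    rw [neg_smul, sub_eq_add_neg]
  -- the same map as an element of the ring `AddMonoid.End E(K̄) ⊇ End_K(E)`
  let ψE : AddMonoid.End W.geomPoints := ψ
  have hψmem : ψE ∈ W.endRing := by
    have h : φ - (a : AddMonoid.End W.geomPoints) ∈ W.endRing :=
      sub_mem (hφ'def ▸ hφ) (intCast_mem W.endRing a)
    convert h using 1
    refine DFunLike.ext _ _ fun P ↦ ?_
    change ψ P = φ' P - (a : AddMonoid.End W.geomPoints) P
    rw [hψapply, AddMonoid.End.intCast_apply]
  have hequiv := (W.mem_equivariantSubring_iff ψE).1 (Subring.mem_inf.1 hψmem).2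
  -- `ψ ≠ 0` (else `φ = a` and `(a² - ta + m) P = 0` for all `P`, but `a² - ta + m ≠ 0`)
  have hfa : a ^ 2 - t * a + m ≠ 0 := by
    intro h0
    nlinarith [sq_nonneg (2 * a - t)]
  have hψ0 : ψ ≠ 0 := by
    intro h0
    apply hfa
    refine int_eq_zero_of_forall_zsmul_eq_zero W fun P ↦ ?_
    have h1 : φ' P = a • P := sub_eq_zero.1 (by rw [← hψapply, h0, AddMonoidHom.zero_apply])
    have h2 := hrel' P
    rw [h1, map_zsmul, h1, smul_smul] at h2
    linear_combination (norm := module) h2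
  have halg : IsAlgebraicOn W W ψ :=
    ((W.mem_geomEndRing_iff_holds ψE).1 (Subring.mem_inf.1 hψmem).1).resolve_left
      fun h ↦ hψ0 h
  let Ψ : Isogeny W W := ⟨ψ, halg, fun σ P ↦ hequiv σ P, halg.finite_ker⟩
  -- `ψ` kills `E[p]`, so `ψ = λ ∘ [p]`
  have hpK' : ((p : ℤ) : K) ≠ 0 := by rwa [Int.cast_natCast]
  obtain ⟨lam, hlam⟩ := Isogeny.exists_eq_comp_zsmul_of_geomTorsion_le_ker hpK' Ψ
    fun P hP ↦ by
      change ψ P = 0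
      rw [hψapply]
      exact hall' P hP
  have hfac : ψ = lam.toAddMonoidHom.comp ((p : ℤ) • AddMonoidHom.id W.geomPoints) :=
    AddMonoidHom.ext fun P ↦ hlam P
  -- degrees: `N(φ - a) = deg ψ = deg λ · p²`
  have h63 := degHom_isQuadraticForm_holds W W
  have hψm : ψ ∈ homModule W W := Ψ.toAddMonoidHom_mem_homModule
  have hφm : φ' ∈ homModule W W := by
    have h : φ' = ψ + a • AddMonoidHom.id _ := by
      rw [hψ, add_assoc, ← add_smul, neg_add_cancel, zero_smul, add_zero]
    rw [h]
    exact add_mem hψm (Submodule.smul_mem _ _ (id_mem_homModule W))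
  have hdegψ : degHom W W ψ = a ^ 2 - t * a + m := degHom_sub_intCast_eq W hφm hrel' hdisc a
  have hdegψ' : degHom W W ψ = degHom W W lam.toAddMonoidHom * (p : ℤ) ^ 2 := by
    rw [hfac, degHom_comp lam.toAddMonoidHom_mem_homModule
      (Submodule.smul_mem _ _ (id_mem_homModule W)), degHom_zsmul h63 (id_mem_homModule W),
      degHom_id, mul_one]
  exact ha ⟨degHom W W lam.toAddMonoidHom, by rw [← hdegψ, hdegψ', mul_comm]⟩


/-! ### Split scalars: a cyclic vector for `φ` on `E[p] = E[𝔭] ⊕ E[𝔭̄]` -/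

section SplitScalars

variable {p : ℕ} [Fact p.Prime] {M : Type*} [AddCommGroup M] [Module (ZMod p) M]

/-- **Eigenvectors for distinct eigenvalues are independent**: if `φ va = a va`, `φ vb = b vb`
with `a ≠ b` and `va, vb ≠ 0`, then `c va + d vb = 0 ⇒ c = d = 0` (apply `φ - b`).
[cite: Rubin1999, Prop. 5.4 (`E[𝔭] ∩ E[𝔭̄] = 0`)] -/
theorem eq_zero_of_smul_eigen_add_smul_eigen_eq_zero (φ : M →ₗ[ZMod p] M) {a b : ZMod p}
    (hab : a ≠ b) {va vb : M} (hva : φ va = a • va) (hvb : φ vb = b • vb) (hva0 : va ≠ 0)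
    (hvb0 : vb ≠ 0) {c d : ZMod p} (h : c • va + d • vb = 0) : c = 0 ∧ d = 0 := by
  have hφ : c • a • va + d • b • vb = 0 := by
    have := congrArg φ h
    rwa [map_add, map_smul, map_smul, hva, hvb, map_zero] at this
  have h1 : (c * (a - b)) • va = 0 := by linear_combination (norm := module) hφ - b • h
  have hc : c = 0 := by
    by_contra hc
    exact hva0 (by rw [← inv_smul_smul₀ (mul_ne_zero hc (sub_ne_zero.2 hab)) va, h1, smul_zero])
  refine ⟨hc, ?_⟩
  by_contra hd
  rw [hc, zero_smul, zero_add] at h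
  exact hvb0 (by rw [← inv_smul_smul₀ hd vb, h, smul_zero])

/-- **`va + vb` is a cyclic vector**: with `va, vb` as above, `α (va + vb) + β φ(va + vb) = 0`
forces `α = β = 0` (the coefficients `α + βa`, `α + βb` vanish and `a ≠ b`).
[cite: Rubin1999, Prop. 5.4] -/
theorem eq_zero_of_smul_add_smul_φ_eq_zero_split (φ : M →ₗ[ZMod p] M) {a b : ZMod p}
    (hab : a ≠ b) {va vb : M} (hva : φ va = a • va) (hvb : φ vb = b • vb) (hva0 : va ≠ 0)
    (hvb0 : vb ≠ 0) {α β : ZMod p} (h : α • (va + vb) + β • φ (va + vb) = 0) :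
    α = 0 ∧ β = 0 := by
  have h' : (α + β * a) • va + (α + β * b) • vb = 0 := by
    rw [map_add, hva, hvb] at h
    linear_combination (norm := module) h
  obtain ⟨h1, h2⟩ := eq_zero_of_smul_eigen_add_smul_eigen_eq_zero φ hab hva hvb hva0 hvb0 h'
  have hβ : β = 0 := by
    have hm : β * (a - b) = 0 := by linear_combination h1 - h2
    exact (mul_eq_zero.1 hm).resolve_right (sub_ne_zero.2 hab)
  refine ⟨?_, hβ⟩
  rw [hβ, zero_mul, add_zero] at h1
  exact h1

/-- **Every endomorphism commuting with `φ` is `a + bφ`, given a cyclic vector** (`M` of order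
`p²`, `v` with `α v + β φv = 0 ⇒ α = β = 0`): the same counting as in the inert case
(`exists_eq_smul_add_smul_of_comm`), the cyclic vector replacing the irreducibility.
[cite: Rubin1999, Prop. 5.4, Cor. 5.5] -/
theorem exists_eq_smul_add_smul_of_comm_of_cyclic (hcard : Nat.card M = p ^ 2)
    (φ : M →ₗ[ZMod p] M) {v : M} (hv : ∀ α β : ZMod p, α • v + β • φ v = 0 → α = 0 ∧ β = 0)
    (g : M →ₗ[ZMod p] M) (hg : ∀ x, g (φ x) = φ (g x)) :
    ∃ a b : ZMod p, ∀ x, g x = a • x + b • φ x := by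
  have hp : p.Prime := Fact.out
  haveI : Finite M :=
    Nat.finite_of_card_ne_zero (by rw [hcard]; exact pow_ne_zero 2 hp.ne_zero)
  let ψ : ZMod p × ZMod p → M := fun q ↦ q.1 • v + q.2 • φ v
  have hinj : Function.Injective ψ := by
    intro q q' hqq'
    have h0 : (q.1 - q'.1) • v + (q.2 - q'.2) • φ v = 0 := by
      have h' : ψ q - ψ q' = 0 := sub_eq_zero.2 hqq'
      rw [← h', sub_smul, sub_smul]
      change _ = q.1 • v + q.2 • φ v - (q'.1 • v + q'.2 • φ v)
      abel
    obtain ⟨h1, h2⟩ := hv _ _ h0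
    exact Prod.ext (sub_eq_zero.1 h1) (sub_eq_zero.1 h2)
  have hbij : Function.Bijective ψ :=
    hinj.bijective_of_nat_card_le (by rw [hcard, Nat.card_prod, Nat.card_zmod, pow_two])
  obtain ⟨⟨a, b⟩, hab⟩ := hbij.2 (g v)
  refine ⟨a, b, fun x ↦ ?_⟩
  obtain ⟨⟨c, d⟩, rfl⟩ := hbij.2 x
  have hgv : g v = a • v + b • φ v := hab.symm
  have hgφv : g (φ v) = a • φ v + b • φ (φ v) := by rw [hg, hgv, map_add, map_smul, map_smul]
  change g (c • v + d • φ v) = a • (c • v + d • φ v) + b • φ (c • v + d • φ v)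
  rw [map_add, map_smul, map_smul, hgv, hgφv, map_add, map_smul, map_smul]
  module

/-- **Two endomorphisms commuting with `φ` commute, given a cyclic vector.**
[cite: Rubin1999, Cor. 5.5, Cor. 5.20] -/
theorem comm_of_comm_of_cyclic (hcard : Nat.card M = p ^ 2) (φ : M →ₗ[ZMod p] M) {v : M}
    (hv : ∀ α β : ZMod p, α • v + β • φ v = 0 → α = 0 ∧ β = 0) (g g' : M →ₗ[ZMod p] M)
    (hg : ∀ x, g (φ x) = φ (g x)) (hg' : ∀ x, g' (φ x) = φ (g' x)) (x : M) :
    g (g' x) = g' (g x) := by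
  obtain ⟨a, b, hab⟩ := exists_eq_smul_add_smul_of_comm_of_cyclic hcard φ hv g hg
  obtain ⟨a', b', hab'⟩ := exists_eq_smul_add_smul_of_comm_of_cyclic hcard φ hv g' hg'
  simp only [map_add, map_smul, hab, hab']
  module

/-- **`g - 1` is bijective when `g` (commuting with `φ`) moves both eigenvectors** (`M` of order
`p²`, split data `a ≠ b`, `va, vb`): `g` is a scalar `λ` on `va` and `μ` on `vb`
(`exists_eq_smul_add_smul_of_comm_of_cyclic`), every `x` is `c va + d vb` by counting, and
`(g - 1)(c va + d vb) = c(λ - 1) va + d(μ - 1) vb` with `λ, μ ≠ 1`.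
[cite: Rubin1999, Lemma 6.1, Lemma 6.2 (i)] -/
theorem bijective_sub_id_of_comm_split (hcard : Nat.card M = p ^ 2) (φ : M →ₗ[ZMod p] M)
    {a b : ZMod p} (hab : a ≠ b) {va vb : M} (hva : φ va = a • va) (hvb : φ vb = b • vb)
    (hva0 : va ≠ 0) (hvb0 : vb ≠ 0) (g : M →ₗ[ZMod p] M) (hg : ∀ x, g (φ x) = φ (g x))
    (hga : g va ≠ va) (hgb : g vb ≠ vb) : Function.Bijective fun x ↦ g x - x := by
  have hp : p.Prime := Fact.out
  haveI : Finite M :=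
    Nat.finite_of_card_ne_zero (by rw [hcard]; exact pow_ne_zero 2 hp.ne_zero)
  obtain ⟨α, β, hg'⟩ := exists_eq_smul_add_smul_of_comm_of_cyclic hcard φ
    (fun _ _ h ↦ eq_zero_of_smul_add_smul_φ_eq_zero_split φ hab hva hvb hva0 hvb0 h) g hg
  have hgva : g va = (α + β * a) • va := by rw [hg', hva]; module
  have hgvb : g vb = (α + β * b) • vb := by rw [hg', hvb]; module
  have hla : α + β * a - 1 ≠ 0 := by
    intro h0
    apply hga
    have h1 : α + β * a = 1 := by linear_combination h0
    rw [hgva, h1, one_smul]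
  have hlb : α + β * b - 1 ≠ 0 := by
    intro h0
    apply hgb
    have h1 : α + β * b = 1 := by linear_combination h0
    rw [hgvb, h1, one_smul]
  -- every `x` is `c va + d vb`
  let ψ : ZMod p × ZMod p → M := fun q ↦ q.1 • va + q.2 • vb
  have hinj : Function.Injective ψ := by
    intro q q' hqq'
    have h0 : (q.1 - q'.1) • va + (q.2 - q'.2) • vb = 0 := by
      have h' : ψ q - ψ q' = 0 := sub_eq_zero.2 hqq'
      rw [← h', sub_smul, sub_smul]
      change _ = q.1 • va + q.2 • vb - (q'.1 • va + q'.2 • vb)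
      abel
    obtain ⟨h1, h2⟩ := eq_zero_of_smul_eigen_add_smul_eigen_eq_zero φ hab hva hvb hva0 hvb0 h0
    exact Prod.ext (sub_eq_zero.1 h1) (sub_eq_zero.1 h2)
  have hbij : Function.Bijective ψ :=
    hinj.bijective_of_nat_card_le (by rw [hcard, Nat.card_prod, Nat.card_zmod, pow_two])
  have key : ∀ c d : ZMod p, g (c • va + d • vb) - (c • va + d • vb) =
      (c * (α + β * a - 1)) • va + (d * (α + β * b - 1)) • vb := by
    intro c d
    rw [map_add, map_smul, map_smul, hgva, hgvb]
    module
  refine Finite.injective_iff_bijective.1 fun x y hxy ↦ ?_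
  obtain ⟨⟨c, d⟩, rfl⟩ := hbij.2 x
  obtain ⟨⟨c', d'⟩, rfl⟩ := hbij.2 y
  have h : g (c • va + d • vb) - (c • va + d • vb) = g (c' • va + d' • vb) - (c' • va + d' • vb) :=
    hxy
  rw [key, key] at h
  have h0 : ((c - c') * (α + β * a - 1)) • va + ((d - d') * (α + β * b - 1)) • vb = 0 := by
    linear_combination (norm := module) h
  obtain ⟨h1, h2⟩ := eq_zero_of_smul_eigen_add_smul_eigen_eq_zero φ hab hva hvb hva0 hvb0 h0
  have hc : c = c' := sub_eq_zero.1 ((mul_eq_zero.1 h1).resolve_right hla)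
  have hd : d = d' := sub_eq_zero.1 ((mul_eq_zero.1 h2).resolve_right hlb)
  change ψ (c, d) = ψ (c', d')
  rw [hc, hd]

end SplitScalars

/-! ### The two CM inputs at a split prime -/

section SplitCurve

variable {p : ℕ} [Fact p.Prime]

/-- **The two CM inputs for `E[p]` at a split prime `p = 𝔭𝔭̄` of `ℤ[φ]`.** Let `φ ∈ End_K(E)` be
`K`-rational with `φ² = tφ - m`, `t² < 4m`, `#E[p] = p²`, `p ≠ 0` in `K`, and `a, b ∈ ℤ` with
`a + b ≡ t`, `ab ≡ m (mod p)`, `a ≢ b (mod p)` (the two roots of `x² - tx + m` mod `p`) and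
`p² ∤ f(a), f(b)`. Then (1) any two elements of `Γ_K` commute on `E[p]` (Cor. 5.5:
`Gal(K(E[p])/K) ↪ (𝒪/p)^× = (𝒪/𝔭)^× × (𝒪/𝔭̄)^×`), and (2) if no non-zero point of `E[p]` is
fixed by all of `Γ_K` (`E[p](K) = 0`), some `g₀ ∈ Γ_K` has `P ↦ g₀P - P` bijective on `E[p]`
(the element of Lemma 6.1, assembled from elements moving `E[𝔭]` and `E[𝔭̄]`). The eigenvectors
`va ∈ E[𝔭] = ker(φ - a)`, `vb ∈ E[𝔭̄]` are `(φ - b)P`, `(φ - a)Q` for the points of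
`exists_mem_geomTorsion_sub_smul_ne_zero` (Prop. 5.4: `E[𝔭] ≠ E[p]`).
[cite: Rubin1999, Prop. 5.4, Cor. 5.5, Lemma 6.1] [cite: Rubin1987Sha, §1] -/
theorem smul_comm_and_exists_bijective_of_split (hcard : Nat.card (geomTorsion W p) = p ^ 2)
    {φ : AddMonoid.End W.geomPoints} (hφ : φ ∈ W.endRing) {t m : ℤ}
    (hrel : ∀ P : W.geomPoints, φ (φ P) = t • φ P - m • P) (hdisc : t ^ 2 < 4 * m)
    (hpK : (p : K) ≠ 0) {a b : ℤ} (hsum : (p : ℤ) ∣ a + b - t) (hprod : (p : ℤ) ∣ a * b - m)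
    (hab : ¬ (p : ℤ) ∣ a - b) (ha : ¬ (p : ℤ) ^ 2 ∣ a ^ 2 - t * a + m)
    (hb : ¬ (p : ℤ) ^ 2 ∣ b ^ 2 - t * b + m) :
    (∀ (σ τ : absoluteGaloisGroup K) (P : geomTorsion W p), σ • τ • P = τ • σ • P) ∧
    ((∀ P : geomTorsion W p, (∀ σ : absoluteGaloisGroup K, σ • P = P) → P = 0) →
      ∃ g₀ : absoluteGaloisGroup K, Function.Bijective fun P : geomTorsion W p ↦ g₀ • P - P) := by
  -- `φ` restricted to `V = E[p]`, an `𝔽_p`-space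
  have hmem : ∀ Q : geomTorsion W p, φ Q ∈ geomTorsion W p := fun Q ↦ by
    rw [mem_geomTorsion_iff, ← map_zsmul, (mem_geomTorsion_iff W p _).1 Q.2, map_zero]
  let φM : geomTorsion W p →+ geomTorsion W p :=
    { toFun := fun Q ↦ ⟨φ Q, hmem Q⟩
      map_zero' := Subtype.ext (by simp)
      map_add' := fun Q Q' ↦ Subtype.ext (by simp) }
  have hpM : ∀ Q : geomTorsion W p, p • Q = 0 := fun Q ↦
    Subtype.ext (by
      rw [AddSubgroupClass.coe_nsmul, ZeroMemClass.coe_zero, ← natCast_zsmul]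
      exact (mem_geomTorsion_iff W p _).1 Q.2)
  have hrelM : ∀ Q : geomTorsion W p, φM (φM Q) = t • φM Q - m • Q := fun Q ↦
    Subtype.ext (by
      rw [AddSubgroupClass.coe_sub, AddSubgroupClass.coe_zsmul, AddSubgroupClass.coe_zsmul]
      exact hrel Q)
  have hequiv := (W.mem_equivariantSubring_iff φ).1 (Subring.mem_inf.1 hφ).2
  have inst : Module (ZMod p) (geomTorsion W p) := AddCommGroup.zmodModule hpM
  let fV : geomTorsion W p →ₗ[ZMod p] geomTorsion W p := φM.toZModLinearMap p
  set A : ZMod p := ((a : ℤ) : ZMod p) with hA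
  set B : ZMod p := ((b : ℤ) : ZMod p) with hB
  have hAB : A ≠ B := by
    intro h
    apply hab
    have h' : ((a - b : ℤ) : ZMod p) = 0 := by
      push_cast
      rw [← hA, ← hB, h, sub_self]
    exact (ZMod.intCast_zmod_eq_zero_iff_dvd _ _).1 h'
  have ht : (t : ZMod p) = A + B := by
    have h0 : ((a + b - t : ℤ) : ZMod p) = 0 := (ZMod.intCast_zmod_eq_zero_iff_dvd _ _).2 hsum
    push_cast at h0
    linear_combination -h0
  have hm : (m : ZMod p) = A * B := by
    have h0 : ((a * b - m : ℤ) : ZMod p) = 0 := (ZMod.intCast_zmod_eq_zero_iff_dvd _ _).2 hprod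
    push_cast at h0
    linear_combination -h0
  have hrelV : ∀ x, fV (fV x) = (A + B) • fV x - (A * B) • x := fun x ↦ by
    rw [← ht, ← hm]
    change φM (φM x) = (t : ZMod p) • φM x - (m : ZMod p) • x
    rw [Int.cast_smul_eq_zsmul, Int.cast_smul_eq_zsmul]
    exact hrelM x
  -- the eigenvectors `va = (φ - b)P ∈ E[𝔭]`, `vb = (φ - a)Q ∈ E[𝔭̄]`
  obtain ⟨P, hP, hPne⟩ := exists_mem_geomTorsion_sub_smul_ne_zero W hφ hrel hdisc hpK hb
  obtain ⟨Q, hQ, hQne⟩ := exists_mem_geomTorsion_sub_smul_ne_zero W hφ hrel hdisc hpK ha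
  set va : geomTorsion W p := fV ⟨P, hP⟩ - B • ⟨P, hP⟩ with hva_def
  set vb : geomTorsion W p := fV ⟨Q, hQ⟩ - A • ⟨Q, hQ⟩ with hvb_def
  have hva0 : va ≠ 0 := fun h0 ↦ hPne (by
    have h1 := congrArg (fun x : geomTorsion W p ↦ (x : W.geomPoints)) h0
    rw [hva_def, hB, Int.cast_smul_eq_zsmul, AddSubgroupClass.coe_sub,
      AddSubgroupClass.coe_zsmul, ZeroMemClass.coe_zero] at h1
    exact h1)
  have hvb0 : vb ≠ 0 := fun h0 ↦ hQne (by
    have h1 := congrArg (fun x : geomTorsion W p ↦ (x : W.geomPoints)) h0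
    rw [hvb_def, hA, Int.cast_smul_eq_zsmul, AddSubgroupClass.coe_sub,
      AddSubgroupClass.coe_zsmul, ZeroMemClass.coe_zero] at h1
    exact h1)
  have hva : fV va = A • va := by rw [hva_def, map_sub, map_smul, hrelV]; module
  have hvb : fV vb = B • vb := by rw [hvb_def, map_sub, map_smul, hrelV]; module
  have hcyc : ∀ α β : ZMod p, α • (va + vb) + β • fV (va + vb) = 0 → α = 0 ∧ β = 0 :=
    fun _ _ h ↦ eq_zero_of_smul_add_smul_φ_eq_zero_split fV hAB hva hvb hva0 hvb0 h
  -- the Galois action commutes with `fV`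
  let gV : absoluteGaloisGroup K → geomTorsion W p →ₗ[ZMod p] geomTorsion W p :=
    fun ρ ↦ (DistribSMul.toAddMonoidHom _ ρ).toZModLinearMap p
  have hgV : ∀ (ρ : absoluteGaloisGroup K) (x : geomTorsion W p), gV ρ x = ρ • x := fun _ _ ↦ rfl
  have hcommV : ∀ (ρ : absoluteGaloisGroup K) (x : geomTorsion W p),
      gV ρ (fV x) = fV (gV ρ x) := fun ρ x ↦ Subtype.ext (by
    change ((ρ • φM x : geomTorsion W p) : W.geomPoints) = φ ((ρ • x : geomTorsion W p) : W.geomPoints)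
    rw [AddSubgroup.torsionBy.coe_smul, AddSubgroup.torsionBy.coe_smul, hequiv]
    rfl)
  refine ⟨fun σ τ x ↦ ?_, fun hfix ↦ ?_⟩
  · -- (1) commutativity
    have h := comm_of_comm_of_cyclic hcard fV hcyc (gV σ) (gV τ) (hcommV σ) (hcommV τ) x
    simpa only [hgV] using h
  · -- (2) an element moving both eigenlines
    obtain ⟨σa, hσa⟩ : ∃ σ : absoluteGaloisGroup K, σ • va ≠ va :=
      not_forall.1 fun h ↦ hva0 (hfix va h)
    obtain ⟨σb, hσb⟩ : ∃ σ : absoluteGaloisGroup K, σ • vb ≠ vb :=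
      not_forall.1 fun h ↦ hvb0 (hfix vb h)
    -- `σb` acts on `vb` as a scalar `μ`
    obtain ⟨α, β, hσb'⟩ :=
      exists_eq_smul_add_smul_of_comm_of_cyclic hcard fV hcyc (gV σb) (hcommV σb)
    have hμ : σb • vb = (α + β * B) • vb := by rw [← hgV, hσb', hvb]; module
    -- choose `g₀ ∈ {σa, σb, σa σb}`
    have hg₀ : ∃ g₀ : absoluteGaloisGroup K, g₀ • va ≠ va ∧ g₀ • vb ≠ vb := by
      by_cases h1 : σa • vb = vb
      · by_cases h2 : σb • va = va
        · refine ⟨σa * σb, ?_, ?_⟩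
          · rw [mul_smul, h2]; exact hσa
          · rw [mul_smul, hμ, ← hgV σa, map_smul, hgV, h1, ← hμ]; exact hσb
        · exact ⟨σb, h2, hσb⟩
      · exact ⟨σa, hσa, h1⟩
    obtain ⟨g₀, hg₀a, hg₀b⟩ := hg₀
    refine ⟨g₀, ?_⟩
    have h := bijective_sub_id_of_comm_split hcard fV hAB hva hvb hva0 hvb0 (gV g₀) (hcommV g₀)
      (by rw [hgV]; exact hg₀a) (by rw [hgV]; exact hg₀b)
    simpa only [hgV] using h

end SplitCurve

/-! ### The descent made unconditional at a split prime -/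

section SplitAssembly

open NumberField IsDedekindDomain

variable {K : Type u} [Field K] [NumberField K] (W : WeierstrassCurve K) {p : ℕ} [Fact p.Prime]

/-- **No non-zero point of `E[p]` is `Γ_K`-fixed when `p ∤ #E(K)_tors`** (a fixed point is
`K`-rational by Galois descent, tree `fixedPoints_eq_range_map_holds`, of order `p` in the finite
group `E(K)_tors`; cf. `exists_not_mem_torsionFixing_of_not_dvd` of `…RubinScalarsProofs`).
[folklore] [cite: SilvermanAEC2009, VIII.§1 (proof of Prop. 1.2)] -/
theorem geomTorsion_eq_zero_of_forall_smul_eq [W.IsElliptic]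
    (hpN : ¬ p ∣ Nat.card (AddCommGroup.torsion (W.baseChange K).toAffine.Point))
    {P : geomTorsion W p} (hP : ∀ σ : absoluteGaloisGroup K, σ • P = P) : P = 0 := by
  have hp : p.Prime := Fact.out
  by_contra hP0
  have hfix : (P : W.geomPoints) ∈
      MulAction.fixedPoints (absoluteGaloisGroup K) W.geomPoints := by
    rw [MulAction.mem_fixedPoints]
    intro σ
    rw [← AddSubgroup.torsionBy.coe_smul, hP σ]
  rw [fixedPoints_eq_range_map_holds W] at hfix
  obtain ⟨Q, hQ⟩ := hfix
  simp only at hQ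
  have hinj : Function.Injective
      (Affine.Point.baseChange K (AlgebraicClosure K) :
        (W.baseChange K).toAffine.Point → W.geomPoints) :=
    Affine.Point.map_injective _
  have hQ0 : Q ≠ 0 := by
    rintro rfl
    apply hP0
    apply Subtype.ext
    rw [ZeroMemClass.coe_zero, ← hQ]
    exact map_zero _
  have hpQ : p • Q = 0 := by
    apply hinj
    rw [map_nsmul, map_zero, hQ, ← natCast_zsmul]
    exact (mem_geomTorsion_iff W p _).1 P.2
  have hord : addOrderOf Q = p := addOrderOf_eq_prime hpQ hQ0
  have hmem : Q ∈ AddCommGroup.torsion (W.baseChange K).toAffine.Point :=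
    (AddCommGroup.mem_torsion Q).2 (isOfFinAddOrder_iff_nsmul_eq_zero.2 ⟨p, hp.pos, hpQ⟩)
  exact hpN (hord ▸ AddSubgroup.addOrderOf_dvd_natCard _ hmem)

/-- **The kernel of restriction vanishes at a split prime** (Lemma 6.2 (i) with both CM inputs
discharged): `ker (H¹(K, E[p]) → H¹(K(E[p]), E[p])) = 0` for `E/K` elliptic over a number field
with a `K`-rational `φ`, `φ² = tφ - m`, `t² < 4m`, a prime `p ∤ #E(K)_tors` and `a, b` as in
`smul_comm_and_exists_bijective_of_split` (`p` split in `ℤ[φ]`, good lifts of the two roots).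
[cite: Rubin1999, Lemma 6.2 (i), Cor. 5.5, Prop. 5.4] -/
theorem subgroupResKer_torsionFixing_eq_bot_of_split [W.IsElliptic]
    {φ : AddMonoid.End W.geomPoints} (hφ : φ ∈ W.endRing) {t m : ℤ}
    (hrel : ∀ P : W.geomPoints, φ (φ P) = t • φ P - m • P) (hdisc : t ^ 2 < 4 * m)
    {a b : ℤ} (hsum : (p : ℤ) ∣ a + b - t) (hprod : (p : ℤ) ∣ a * b - m)
    (hab : ¬ (p : ℤ) ∣ a - b) (ha : ¬ (p : ℤ) ^ 2 ∣ a ^ 2 - t * a + m)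
    (hb : ¬ (p : ℤ) ^ 2 ∣ b ^ 2 - t * b + m)
    (hpN : ¬ p ∣ Nat.card (AddCommGroup.torsion (W.baseChange K).toAffine.Point)) :
    subgroupResKer (geomTorsion W p) (torsionFixing W p) = ⊥ := by
  have hp : p.Prime := Fact.out
  have hpK : (p : K) ≠ 0 := Nat.cast_ne_zero.2 hp.ne_zero
  have hcard : Nat.card (geomTorsion W p) = p ^ 2 := W.natCard_geomTorsion_eq_sq hpK
  obtain ⟨hcomm, hbij⟩ := smul_comm_and_exists_bijective_of_split W hcard hφ hrel hdisc hpK hsum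
    hprod hab ha hb
  obtain ⟨g₀, hg₀⟩ := hbij fun P hP ↦ geomTorsion_eq_zero_of_forall_smul_eq W hpN hP
  refine subgroupResKer_torsionFixing_eq_bot W p
    (isOpen_torsionFixing W (Nat.cast_ne_zero.2 hp.ne_zero)) (fun x y ↦ ?_) hg₀
  refine ⟨x⁻¹ * y⁻¹ * x * y, (mem_torsionFixing_iff W p).2 fun P ↦ ?_, by group⟩
  rw [mul_smul, mul_smul, mul_smul, hcomm x y P, inv_smul_smul, inv_smul_smul]

/-- **`Ш(E/K)[p] = 0` from the vanishing of `Hom_{Γ_K}(Γ_{K(E[p])}, E[p]; S)`, unconditionally at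
a split prime** (hypotheses of `subgroupResKer_torsionFixing_eq_bot_of_split`,
`S ⊇ {bad places} ∪ {v ∣ p}`): if every `Γ_K`-equivariant continuous homomorphism
`Γ_{K(E[p])} → E[p]` unramified outside `S` vanishes, then `Sel^{(p)}(E/K) = 0` and
`Ш(E/K)[p] = 0` — the split-prime companion of
`sha_torsionBy_eq_zero_of_forall_unramifiedHoms_eq_zero_of_mem_endRing`.
[cite: Rubin1987Sha, Thm. 6.6, (1.2)] [cite: Rubin1999, Thm. 6.5, Cor. 6.10, Remark 10.11] -/
theorem sha_torsionBy_eq_zero_of_forall_unramifiedHoms_eq_zero_of_split [W.IsElliptic]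
    {φ : AddMonoid.End W.geomPoints} (hφ : φ ∈ W.endRing) {t m : ℤ}
    (hrel : ∀ P : W.geomPoints, φ (φ P) = t • φ P - m • P) (hdisc : t ^ 2 < 4 * m)
    {a b : ℤ} (hsum : (p : ℤ) ∣ a + b - t) (hprod : (p : ℤ) ∣ a * b - m)
    (hab : ¬ (p : ℤ) ∣ a - b) (ha : ¬ (p : ℤ) ^ 2 ∣ a ^ 2 - t * a + m)
    (hb : ¬ (p : ℤ) ^ 2 ∣ b ^ 2 - t * b + m)
    (hpN : ¬ p ∣ Nat.card (AddCommGroup.torsion (W.baseChange K).toAffine.Point))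
    {S : Set (HeightOneSpectrum (𝓞 K))} (hbad : W.badPlaces (𝓞 K) ⊆ S)
    (hdiv : ∀ v : HeightOneSpectrum (𝓞 K), (p : 𝓞 K) ∈ v.asIdeal → v ∈ S)
    (hHom : ∀ f ∈ unramifiedHoms (torsionFixing W p) (geomTorsion W p) S,
      (∀ (σ : absoluteGaloisGroup K) (u : torsionFixing W p),
        f ⟨σ * u * σ⁻¹, (torsionFixing_normal W p).conj_mem _ u.2 σ⟩ = σ • f u) → f = 0)
    (c : W.sha) (hc : p • c = 0) : c = 0 := by
  have hp : p.Prime := Fact.out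
  have hn : ((p : ℕ) : ℤ) ≠ 0 := Nat.cast_ne_zero.2 hp.ne_zero
  exact sha_torsionBy_eq_zero_of_forall_unramifiedHoms_eq_zero W p hn
    (subgroupResKer_torsionFixing_eq_bot_of_split W hφ hrel hdisc hsum hprod hab ha hb hpN) hbad
    (fun v hv ↦ hdiv v (by rwa [Int.cast_natCast] at hv)) hHom c (by rw [natCast_zsmul]; exact hc)

end SplitAssembly

/-! ### All but finitely many primes: inert or split -/

section Cofinite

open NumberField IsDedekindDomain

/-- **A good lift of a simple root.** If `x² - tx + m` has a root mod a prime `p ∤ t² - 4m`, there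
are integers `a, b` with `p ∣ a + b - t`, `p ∣ ab - m`, `p ∤ a - b` and
`p² ∤ a² - ta + m`, `p² ∤ b² - tb + m`: with `r` a lift of the root, `a ∈ {r, r + p}`
(`f(r + p) = f(r) + p(2r - t) + p²`, and `p ∤ 2r - t` because `(2r - t)² = 4f(r) + (t² - 4m)`),
`b = t - a` (`f(b) = f(a)`, `ab - m = -f(a)`, `a - b = 2a - t`). [folklore] -/
theorem exists_split_data {p : ℕ} (hp : p.Prime) {t m : ℤ} (hdisc : ¬ (p : ℤ) ∣ t ^ 2 - 4 * m)
    (hroot : ∃ r : ZMod p, r * r - t * r + m = 0) :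
    ∃ a b : ℤ, (p : ℤ) ∣ a + b - t ∧ (p : ℤ) ∣ a * b - m ∧ ¬ (p : ℤ) ∣ a - b ∧
      ¬ (p : ℤ) ^ 2 ∣ a ^ 2 - t * a + m ∧ ¬ (p : ℤ) ^ 2 ∣ b ^ 2 - t * b + m := by
  haveI := Fact.mk hp
  obtain ⟨r, hr⟩ := hroot
  obtain ⟨r₀, rfl⟩ := ZMod.intCast_surjective r
  have hpr : (p : ℤ) ∣ r₀ ^ 2 - t * r₀ + m := by
    refine (ZMod.intCast_zmod_eq_zero_iff_dvd _ _).1 ?_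
    push_cast
    linear_combination hr
  -- `p ∤ 2r - t` for every integer `r` with `p ∣ f(r)`
  have hder : ∀ r : ℤ, (p : ℤ) ∣ r ^ 2 - t * r + m → ¬ (p : ℤ) ∣ 2 * r - t := by
    intro r hr hd
    apply hdisc
    have h2 : t ^ 2 - 4 * m = (2 * r - t) ^ 2 - 4 * (r ^ 2 - t * r + m) := by ring
    rw [h2]
    exact dvd_sub (dvd_pow hd two_ne_zero) (dvd_mul_of_dvd_right hr 4)
  -- the good lift `a`
  obtain ⟨a, hpa, hpa2⟩ : ∃ a : ℤ, (p : ℤ) ∣ a ^ 2 - t * a + m ∧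
      ¬ (p : ℤ) ^ 2 ∣ a ^ 2 - t * a + m := by
    by_cases h2 : (p : ℤ) ^ 2 ∣ r₀ ^ 2 - t * r₀ + m
    · refine ⟨r₀ + p, ?_, fun h ↦ ?_⟩
      · have h3 : (r₀ + p) ^ 2 - t * (r₀ + p) + m =
            (r₀ ^ 2 - t * r₀ + m) + p * (2 * r₀ - t + p) := by ring
        rw [h3]
        exact dvd_add hpr (dvd_mul_right _ _)
      · have h3 : (p : ℤ) * (p : ℤ) ∣ (p : ℤ) * (2 * r₀ - t) := by
          have h4 : (p : ℤ) * (2 * r₀ - t) =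
              ((r₀ + p) ^ 2 - t * (r₀ + p) + m) - (r₀ ^ 2 - t * r₀ + m) - p ^ 2 := by ring
          rw [h4, ← pow_two]
          exact dvd_sub (dvd_sub h h2) (dvd_refl _)
        exact hder r₀ hpr ((mul_dvd_mul_iff_left (by exact_mod_cast hp.ne_zero)).1 h3)
    · exact ⟨r₀, hpr, h2⟩
  refine ⟨a, t - a, ⟨0, by ring⟩, ?_, ?_, hpa2, ?_⟩
  · have h : a * (t - a) - m = -(a ^ 2 - t * a + m) := by ring
    rw [h]
    exact (dvd_neg).2 hpa
  · have h : a - (t - a) = 2 * a - t := by ring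
    rw [h]
    exact hder a hpa
  · have h : (t - a) ^ 2 - t * (t - a) + m = a ^ 2 - t * a + m := by ring
    rw [h]
    exact hpa2

variable {K : Type u} [Field K] [NumberField K] (W : WeierstrassCurve K)

/-- **Cofinite form at all primes (the shape of Rubin's Thm. 6.6 / Thm. A (b), descent side).**
Let `E/K` be an elliptic curve over a number field with a `K`-rational endomorphism `φ`,
`φ² = tφ - m`, `t² < 4m` (complex multiplication by `ℤ[φ]` defined over `K`). There is `N > 0`
(namely `#E(K)_tors · (4m - t²)`) such that for every prime `p ∤ N` — inert
(`…RubinScalarsProofs`) or split (this file, `exists_split_data`) in `ℤ[φ]` — and every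
`S ⊇ {bad places} ∪ {v ∣ p}`: if every `Γ_K`-equivariant continuous homomorphism
`Γ_{K(E[p])} → E[p]` unramified outside `S` vanishes, then `Ш(E/K)[p] = 0`. All inputs of the
descent (Rubin 1999, Lemma 6.2 (i), Lemma 6.4, Thm. 6.5; Rubin 1987, §1) are thereby discharged;
what Rubin's proof of Thm. 6.6 adds — the finer group of Thm. 6.9 (local condition at `𝔭`,
Lemma 6.8), class field theory, and the vanishing from Cor. 6.10 + Thm. 10.8 + Prop. 10.6 + Wiles'
reciprocity for `𝔭 ∤ 𝒴` — is displayed as the hypothesis `hHom`.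
[cite: Rubin1987Sha, Thm. 6.6, Thm. A (b), (1.2)] [cite: Rubin1999, Thm. 6.5, Cor. 6.10, Remark 10.11] -/
theorem exists_forall_prime_sha_torsionBy_eq_zero [W.IsElliptic]
    {φ : AddMonoid.End W.geomPoints} (hφ : φ ∈ W.endRing) {t m : ℤ}
    (hrel : ∀ P : W.geomPoints, φ (φ P) = t • φ P - m • P) (hdisc : t ^ 2 < 4 * m) :
    ∃ N : ℕ, 0 < N ∧ ∀ p : ℕ, p.Prime → ¬ p ∣ N →
      ∀ {S : Set (HeightOneSpectrum (𝓞 K))}, W.badPlaces (𝓞 K) ⊆ S →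
        (∀ v : HeightOneSpectrum (𝓞 K), (p : 𝓞 K) ∈ v.asIdeal → v ∈ S) →
        (∀ f ∈ unramifiedHoms (torsionFixing W p) (geomTorsion W p) S,
          (∀ (σ : absoluteGaloisGroup K) (u : torsionFixing W p),
            f ⟨σ * u * σ⁻¹, (torsionFixing_normal W p).conj_mem _ u.2 σ⟩ = σ • f u) → f = 0) →
        ∀ c : W.sha, p • c = 0 → c = 0 := by
  haveI : Finite (AddCommGroup.torsion (W.baseChange K).toAffine.Point) :=
    (W.baseChange K).finite_torsion_point
  set T : ℕ := Nat.card (AddCommGroup.torsion (W.baseChange K).toAffine.Point) with hT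
  set D : ℕ := (4 * m - t ^ 2).toNat with hD
  have hDint : (D : ℤ) = 4 * m - t ^ 2 := Int.toNat_of_nonneg (by omega)
  have hD0 : 0 < D := Int.lt_toNat.2 (by omega)
  refine ⟨T * D, Nat.mul_pos Nat.card_pos hD0, fun p hp hpN S hbad hdiv hHom c hc ↦ ?_⟩
  haveI := Fact.mk hp
  have hpT : ¬ p ∣ T := fun h ↦ hpN (dvd_mul_of_dvd_left h D)
  have hpD : ¬ (p : ℤ) ∣ t ^ 2 - 4 * m := by
    intro h
    apply hpN
    apply dvd_mul_of_dvd_right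
    have h' : (p : ℤ) ∣ (D : ℤ) := by
      rw [hDint, ← neg_sub]
      exact (dvd_neg).2 h
    exact Int.natCast_dvd_natCast.1 h'
  by_cases hroot : ∃ r : ZMod p, r * r - t * r + m = 0
  · -- `p` split in `ℤ[φ]`
    obtain ⟨a, b, hsum, hprod, hab, ha, hb⟩ := exists_split_data hp hpD hroot
    exact sha_torsionBy_eq_zero_of_forall_unramifiedHoms_eq_zero_of_split W hφ hrel hdisc hsum
      hprod hab ha hb hpT hbad hdiv hHom c hc
  · -- `p` inert in `ℤ[φ]`
    have hirr : ∀ a : ZMod p, a * a - t * a + m ≠ 0 := fun a h ↦ hroot ⟨a, h⟩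
    obtain ⟨g₀, hg₀⟩ := exists_not_mem_torsionFixing_of_not_dvd W hp hpT
    exact sha_torsionBy_eq_zero_of_forall_unramifiedHoms_eq_zero_of_mem_endRing W hφ hrel hirr
      hg₀ hbad hdiv hHom c hc

end Cofinite

end Rubin1987

end Literature.NumberTheory.EllipticCurves

end
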